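import Summits.Ventures.CertifiedManyBodySolver.Transport.D4VecAction
import Literature.MathematicalPhysics.QuantumLattice.HubbardNNNHoppingPairCorrelatorD4Certificate
import HarnessLib

/-!
# The `D₄` transport of the `d`-wave pair words on `ℤ²`: `Γ(γ) Φ_x = χ_{B₁g}(γ) Φ_{γx+w}`, hence
# `ω(Γ(γ)(Φ_x† Φ_y)) = ω(Φ_{γx}† Φ_{γy})` and the pair-ODLRO ceiling from `D₄`-ORBIT rows (leg-J certificates)

HONEST FRAMING: first certified bounds on pairing observables; not a superconductivity verdict; every
number certified (two lineages + referee) or labelled float. Crew hubbard-obs (D-0042), seat hubbard-obs-p1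
(`prover-hubbard-obs-p1-g0-0`). Theorem-only; zero compute; no named fact; no `sorry`.

Why: the point-group-reduced (leg J = SU(2) × D₄) certificates of rung 0b-lite conclude ORBIT-MEAN rows
`SquareTTPrimeCorrOrbitLowerRow … S Λ X` — a bound on `|S|⁻¹ Σ_{γ∈S} Re ω_{γΛ}(Γ(d4Emb γ 0 Λ) X)`
(`HubbardNNNHoppingTorusLimitCorrelator`, `Rows/DopedTLCorr.lean`, `Rows/DopedTLCorrLambdaOrbit.lean`).
For the pair words this file identifies the rotated copies: the infinite-lattice twin of the torus lemma
`relabel_d4Perm_localPair_of_parity` (`HubbardNNNHoppingPairCorrelatorD4Certificate`).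

* `fermionEmbed_d4Emb_cAt` — `Γ(d4Emb γ w Λ) c_{xσ} = c_{γx+w, σ}`;
* `fermionEmbed_d4Emb_localPairAt` — for a form factor of parity `χ` under `γ` on the step set
  `{0} ∪ unitSteps` (`g(γe) = χ g(e)`, `χ² = 1`; the `d`-wave factor has `χ = b1gSign γ`):
  `Γ(d4Emb γ w (pairRegion S x)) Φ^g_x = χ • Γ(incl) Φ^g_{γx+w}`;
* `expect_d4Emb_dWavePairWord` — `ω(Γ(d4Emb γ w)(Γ Φ_x† · Γ Φ_y)) = ω.dWavePairCorr (γx+w) (γy+w)` (`χ² = 1`):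
  the `D₄`-ORBIT row of the pair word at `(0, r)` is the orbit MEAN of `P_d` over the class of `r` (what a
  leg-J certificate for "P̄_d class(r)" certifies), for every state (no invariance of `ω` needed).
The box-word transport and the pair-ODLRO ceiling from ORBIT rows (each rotated copy of `pairBoxWord B`
dominates `|B|²·braggWeight μ ![0]`) follow in the companion file `Observables/PairBoxWordD4.lean`
(imports `Observables/PairODLROCeilingTL.lean`).
-/

noncomputable section

namespace Summit.Ventures.CertifiedManyBodySolver.Observables

open Matrix Literature.MathematicalPhysics.QuantumLattice Literature.Probability.LatticeModels
open MeasureTheory Complex Filter Topology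
open scoped BigOperators ComplexOrder

/-! ## §1  `d4Vec γ` on the step set (additivity etc. are in `Transport/D4VecAction.lean`) -/

section D4Vec

open Summit.Ventures.CertifiedManyBodySolver.Transport

/-- `d4Vec γ` maps the step set `{0} ∪ unitSteps` onto itself (surjectivity, from injectivity on a finite
set mapped into itself). [folklore] -/
theorem exists_d4Vec_eq_of_mem_steps (γ : DihedralGroup 4) {e' : Site 2}
    (he' : e' ∈ insert (0 : Site 2) unitSteps) :
    ∃ e ∈ insert (0 : Site 2) unitSteps, d4Vec γ e = e' := by
  have hmaps : ∀ e ∈ insert (0 : Site 2) unitSteps, d4Vec γ e ∈ insert (0 : Site 2) unitSteps := by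
    intro e he
    rcases Finset.mem_insert.1 he with rfl | he
    · exact Finset.mem_insert.2 (Or.inl ((d4Vec_eq_zero_iff γ 0).2 rfl))
    · exact Finset.mem_insert_of_mem (d4Vec_mem_unitSteps γ he)
  obtain ⟨e, he, hee⟩ := Finset.surj_on_of_inj_on_of_card_le (s := insert (0 : Site 2) unitSteps)
    (t := insert (0 : Site 2) unitSteps) (fun e _ => d4Vec γ e) (fun e he => hmaps e he)
    (fun a b _ _ h => d4Vec_injective γ h) le_rfl e' he'
  exact ⟨e, he, hee.symm⟩

end D4Vec

/-! ## §2  Transport of the pair words -/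

section Transport

open Summit.Ventures.CertifiedManyBodySolver.Transport

/-- **`Γ(d4Emb γ w Λ) c_{xσ} = c_{γx + w, σ}`.** [folklore] -/
theorem fermionEmbed_d4Emb_cAt (γ : DihedralGroup 4) (w : Site 2) {Λ : Finset (Site 2)} (x : Site 2)
    (hx : x ∈ Λ) (σ : Fin 2) :
    fermionEmbed (PolySite.d4Emb γ w Λ) (cAt x hx σ) =
      cAt (d4Vec γ x + w) (d4Vec_add_mem_d4ShiftSet γ w hx) σ :=
  fermionEmbed_annihilation _ _ _

/-- The rotated pair region sits inside the image region: `pairRegion S (γx + w) ⊆ γ(pairRegion S x) + w`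
for the `D₄`-invariant step set `S = {0} ∪ unitSteps`. [folklore] -/
theorem pairRegion_d4Vec_subset (γ : DihedralGroup 4) (w x : Site 2) :
    pairRegion (insert (0 : Site 2) unitSteps) (d4Vec γ x + w) ⊆
      d4ShiftSet γ w (pairRegion (insert (0 : Site 2) unitSteps) x) := by
  intro z hz
  rcases Finset.mem_insert.1 hz with rfl | hz
  · exact d4Vec_add_mem_d4ShiftSet γ w (self_mem_pairRegion _ x)
  · obtain ⟨e', he', rfl⟩ := Finset.mem_image.1 hz
    obtain ⟨e, he, rfl⟩ := exists_d4Vec_eq_of_mem_steps γ he'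
    have h : d4Vec γ (x + e) + w = d4Vec γ x + w + d4Vec γ e := by rw [d4Vec_add, add_right_comm]
    exact h ▸ d4Vec_add_mem_d4ShiftSet γ w (add_mem_pairRegion x he)

/-- **Transport of the local pair**: for a form factor `g` of parity `χ` under `γ` on `{0} ∪ unitSteps`
(`g (γ e) = χ g(e)`, `χ² = 1`), `Γ(d4Emb γ w (pairRegion S x)) Φ^g_x = χ • Γ(incl) Φ^g_{γx + w}`. The
infinite-lattice twin of `relabel_d4Perm_localPair_of_parity`. [folklore] -/
theorem fermionEmbed_d4Emb_localPairAt (γ : DihedralGroup 4) (w x : Site 2) (g : Site 2 → ℝ) (χ : ℝ)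
    (hg : ∀ e ∈ insert (0 : Site 2) unitSteps, g (d4Vec γ e) = χ * g e) (hχ : χ * χ = 1) :
    fermionEmbed (PolySite.d4Emb γ w (pairRegion (insert (0 : Site 2) unitSteps) x))
        (localPairAt (insert (0 : Site 2) unitSteps) g x) =
      ((χ : ℝ) : ℂ) • fermionEmbed (PolySite.incl (pairRegion_d4Vec_subset γ w x))
        (localPairAt (insert (0 : Site 2) unitSteps) g (d4Vec γ x + w)) := by
  set S : Finset (Site 2) := insert (0 : Site 2) unitSteps with hS
  -- the summand at step `e'` of the target pair at `γx + w`, embedded into the image region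
  set W : Site 2 → FermionOp (d4ShiftSet γ w (pairRegion S x)) := fun e' =>
    if he' : e' ∈ S then
      ((g e' / Real.sqrt 2 : ℝ) : ℂ) •
        (cAt (d4Vec γ x + w) (pairRegion_d4Vec_subset γ w x (self_mem_pairRegion S _)) 0 *
            cAt (d4Vec γ x + w + e') (pairRegion_d4Vec_subset γ w x (add_mem_pairRegion _ he')) 1 -
          cAt (d4Vec γ x + w) (pairRegion_d4Vec_subset γ w x (self_mem_pairRegion S _)) 1 *
            cAt (d4Vec γ x + w + e') (pairRegion_d4Vec_subset γ w x (add_mem_pairRegion _ he')) 0)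
    else 0 with hW
  -- right-hand side: `χ • Σ_{e' ∈ S} W e'`
  have hR : fermionEmbed (PolySite.incl (pairRegion_d4Vec_subset γ w x)) (localPairAt S g (d4Vec γ x + w)) =
      ∑ e' ∈ S, W e' := by
    unfold localPairAt
    rw [fermionEmbed_sum, ← Finset.sum_attach S]
    refine Finset.sum_congr rfl fun e _ => ?_
    rw [hW]; dsimp only
    rw [dif_pos e.2, fermionEmbed_smul, fermionEmbed_sub, fermionEmbed_mul, fermionEmbed_mul]
    simp only [fermionEmbed_incl_cAt]
  -- left-hand side: `Σ_{e ∈ S} (g e/√2) • (word at γx+w, γ(x+e)+w) = Σ_{e ∈ S} χ • W (γ e)`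
  have hL : fermionEmbed (PolySite.d4Emb γ w (pairRegion S x)) (localPairAt S g x) = ∑ e ∈ S, ((χ : ℝ) : ℂ) • W (d4Vec γ e) := by
    unfold localPairAt
    rw [fermionEmbed_sum, ← Finset.sum_attach S (fun e => ((χ : ℝ) : ℂ) • W (d4Vec γ e))]
    refine Finset.sum_congr rfl fun e _ => ?_
    have hγe : d4Vec γ e.1 ∈ S := by
      rcases Finset.mem_insert.1 e.2 with h0 | he
      · exact Finset.mem_insert.2 (Or.inl ((d4Vec_eq_zero_iff γ _).2 h0))
      · exact Finset.mem_insert_of_mem (d4Vec_mem_unitSteps γ he)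
    rw [hW]; dsimp only
    rw [dif_pos hγe, fermionEmbed_smul, fermionEmbed_sub, fermionEmbed_mul, fermionEmbed_mul]
    simp only [fermionEmbed_d4Emb_cAt]
    have hsite : d4Vec γ (x + e.1) + w = d4Vec γ x + w + d4Vec γ e.1 := by rw [d4Vec_add, add_right_comm]
    rw [cAt_congr _ (pairRegion_d4Vec_subset γ w x (add_mem_pairRegion _ hγe)) hsite 1,
      cAt_congr _ (pairRegion_d4Vec_subset γ w x (add_mem_pairRegion _ hγe)) hsite 0,
      smul_smul, ← Complex.ofReal_mul, hg e.1 e.2]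
    congr 2
    rw [show χ * (χ * g e.1 / Real.sqrt 2) = (χ * χ) * g e.1 / Real.sqrt 2 by ring, hχ, one_mul]
  rw [hL, hR, Finset.smul_sum]
  -- reindex `e ↦ γ e` (a permutation of `S`)
  exact Finset.sum_bij (fun e _ => d4Vec γ e)
    (fun e he => by
      rcases Finset.mem_insert.1 he with h0 | he
      · exact Finset.mem_insert.2 (Or.inl ((d4Vec_eq_zero_iff γ _).2 h0))
      · exact Finset.mem_insert_of_mem (d4Vec_mem_unitSteps γ he))
    (fun a _ b _ h => d4Vec_injective γ h)
    (fun e' he' => by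
      obtain ⟨e, he, hee⟩ := exists_d4Vec_eq_of_mem_steps γ he'
      exact ⟨e, he, hee⟩)
    (fun e _ => rfl)

/-- The `d`-wave case: `Γ(d4Emb γ w (pairRegion S x)) Φ_x = b1gSign γ • Γ(incl) Φ_{γx + w}`.
[cite: Scalapino1995, §2 eq. (2.3)] -/
theorem fermionEmbed_d4Emb_localPairAt_dWave (γ : DihedralGroup 4) (w x : Site 2) :
    fermionEmbed (PolySite.d4Emb γ w (pairRegion (insert (0 : Site 2) unitSteps) x))
        (localPairAt (insert (0 : Site 2) unitSteps) dWaveFormFactor x) =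
      ((b1gSign γ : ℝ) : ℂ) • fermionEmbed (PolySite.incl (pairRegion_d4Vec_subset γ w x))
        (localPairAt (insert (0 : Site 2) unitSteps) dWaveFormFactor (d4Vec γ x + w)) :=
  fermionEmbed_d4Emb_localPairAt γ w x dWaveFormFactor (b1gSign γ)
    (fun e _ => dWaveFormFactor_d4Vec_eq_b1gSign_mul γ e) (b1gSign_mul_self γ)

end Transport

/-! ## §3  The pair two-point word under `D₄`: `ω(Γ(γ)(Γ Φ_x† · Γ Φ_y)) = ω.dWavePairCorr (γx + w) (γy + w)` -/

section TwoPoint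

/-- `d4ShiftSet γ w` is monotone in the region. [folklore] -/
theorem d4ShiftSet_mono (γ : DihedralGroup 4) (w : Site 2) {Λ Λ' : Finset (Site 2)} (h : Λ ⊆ Λ') :
    d4ShiftSet γ w Λ ⊆ d4ShiftSet γ w Λ' :=
  Finset.map_subset_map.2 h

/-- Isotony and the affine `D₄` maps commute: `(incl h) ≫ d4Emb γ w Λ' = d4Emb γ w Λ ≫ incl (γh)`. [folklore] -/
theorem incl_trans_d4Emb (γ : DihedralGroup 4) (w : Site 2) {Λ Λ' : Finset (Site 2)} (h : Λ ⊆ Λ') :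
    (PolySite.incl h).trans (PolySite.d4Emb γ w Λ') =
      (PolySite.d4Emb γ w Λ).trans (PolySite.incl (d4ShiftSet_mono γ w h)) :=
  DFunLike.ext _ _ fun _ => Subtype.ext rfl

/-- `Γ(d4Emb γ w Λ') ∘ Γ(incl h) = Γ(incl (γh)) ∘ Γ(d4Emb γ w Λ)` on operators. [folklore] -/
theorem fermionEmbed_d4Emb_fermionEmbed_incl (γ : DihedralGroup 4) (w : Site 2) {Λ Λ' : Finset (Site 2)}
    (h : Λ ⊆ Λ') (A : FermionOp Λ) :
    fermionEmbed (PolySite.d4Emb γ w Λ') (fermionEmbed (PolySite.incl h) A) =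
      fermionEmbed (PolySite.incl (d4ShiftSet_mono γ w h)) (fermionEmbed (PolySite.d4Emb γ w Λ) A) := by
  rw [fermionEmbed_fermionEmbed, fermionEmbed_fermionEmbed, incl_trans_d4Emb]

/-- **The rotated `d`-wave pair two-point word is the pair two-point word at the rotated sites** (the two
`B₁g` signs cancel): for every `ω`, `γ ∈ D₄`, `w, x, y ∈ ℤ²`,
`ω_{γΛ+w}(Γ(d4Emb γ w Λ)(Γ(incl) Φ_x† · Γ(incl) Φ_y)) = ω.dWavePairCorr (γx + w) (γy + w)`,
`Λ = pairRegion S x ∪ pairRegion S y`. In particular the `D₄`-orbit row of the word `P_d(0, r)` is the orbit MEAN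
`|S|⁻¹ Σ_{γ∈S} P_d(0, γr)` of the pair correlator over the class of `r` (translation-invariant `ω`).
[cite: Scalapino1995, §2 eq. (2.3)] -/
theorem expect_d4Emb_dWavePairWord (ω : InfVolFermionState 2) (γ : DihedralGroup 4) (w x y : Site 2) :
    ω.expect (d4ShiftSet γ w (pairRegion (insert (0 : Site 2) unitSteps) x ∪ pairRegion (insert (0 : Site 2) unitSteps) y))
      (fermionEmbed (PolySite.d4Emb γ w _)
        (fermionEmbed (PolySite.incl Finset.subset_union_left)
            (localPairAt (insert (0 : Site 2) unitSteps) dWaveFormFactor x)ᴴ *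
          fermionEmbed (PolySite.incl Finset.subset_union_right)
            (localPairAt (insert (0 : Site 2) unitSteps) dWaveFormFactor y))) =
      ω.dWavePairCorr (d4Vec γ x + w) (d4Vec γ y + w) := by
  rw [map_mul, fermionEmbed_d4Emb_fermionEmbed_incl, fermionEmbed_d4Emb_fermionEmbed_incl,
    fermionEmbed_conjTranspose, fermionEmbed_d4Emb_localPairAt_dWave, fermionEmbed_d4Emb_localPairAt_dWave,
    Matrix.conjTranspose_smul, fermionEmbed_smul, fermionEmbed_smul, ← fermionEmbed_conjTranspose,
    fermionEmbed_fermionEmbed, fermionEmbed_fermionEmbed, PolySite.incl_trans, PolySite.incl_trans,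
    Matrix.smul_mul, Matrix.mul_smul, smul_smul, map_smul]
  have hχ : star (((b1gSign γ : ℝ)) : ℂ) * (((b1gSign γ : ℝ)) : ℂ) = 1 := by
    rw [Complex.star_def, Complex.conj_ofReal, ← Complex.ofReal_mul, b1gSign_mul_self, Complex.ofReal_one]
  rw [hχ, one_smul]
  exact (ω.corr_eq_expect_of_subset _ _ _ _).symm

/-- Real parts, the form read by the rows: `Re ω_{γΛ+w}(Γ(d4Emb γ w Λ) (pair word at (x, y))) =
Re ω.dWavePairCorr (γx + w) (γy + w)`. [cite: Scalapino1995, §2 eq. (2.3)] -/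
theorem re_expect_d4Emb_dWavePairWord (ω : InfVolFermionState 2) (γ : DihedralGroup 4) (w x y : Site 2) :
    (ω.expect (d4ShiftSet γ w (pairRegion (insert (0 : Site 2) unitSteps) x ∪ pairRegion (insert (0 : Site 2) unitSteps) y))
      (fermionEmbed (PolySite.d4Emb γ w _)
        (fermionEmbed (PolySite.incl Finset.subset_union_left)
            (localPairAt (insert (0 : Site 2) unitSteps) dWaveFormFactor x)ᴴ *
          fermionEmbed (PolySite.incl Finset.subset_union_right)
            (localPairAt (insert (0 : Site 2) unitSteps) dWaveFormFactor y)))).re =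
      (ω.dWavePairCorr (d4Vec γ x + w) (d4Vec γ y + w)).re := by
  rw [expect_d4Emb_dWavePairWord]

end TwoPoint

end Summit.Ventures.CertifiedManyBodySolver.Observables

end
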